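import Summits.Ventures.PackingBounds.Configurations.GroundStateSeries
import Summits.Ventures.PackingBounds.Configurations.IcosahedronUnique
import Summits.Ventures.PackingBounds.Energy.UniversalOptimalityIcosahedron

/-!
# Uniqueness of the icosahedral ground state for absolutely monotone and Riesz potentials

Framing: lottery ticket; floor = certified bounds/negative ranges. Venture `PackingBounds` (cell
`pub-packcert`, seat `pub-packcert-energy`) — Cohn–Kumar Table 1, row `(3, 12)`: the uniqueness clause of
Cohn–Kumar's Theorem 1.2 in full strength.

`IcosahedronUnique.isometric_icosahedron_of_ckPow_energy_eq` proves uniqueness of the `12`-point ground state of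
`(1+t)^k` (`k ≥ 6`). With the tree's universal `(1+t)^k` bounds (`Energy.UniversalIcosahedron.ckPow_energy_ge`) and
`GroundStateSeries`: **if `a` is absolutely monotone on `[-1,1)` with `a^(k)(-1) > 0` for some `k ≥ 6`, every
`12`-point configuration on `S²` with the minimal `a`-energy is an isometric image of the regular icosahedron
`Config.Icosahedron.pts`** (`isometric_pts_of_energy_eq_of_absolutelyMonotoneOn`); in particular **the regular
icosahedron is the unique minimiser of every Riesz energy `Σ |x - y|^(-2p)`, `p > 0`, among `12` points on `S²`**
(`riesz_ground_state_unique`; `p = 1/2` is the Thomson problem for `N = 12`).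

## References
* H. Cohn, A. Kumar, J. Amer. Math. Soc. 20 (2007) 99–148, Theorem 1.2 and Table 1. [`CohnKumar2006`]
-/

noncomputable section

namespace Summit.Ventures.PackingBounds.Config.IcosahedronGroundState

open Finset Set

/-- The three inner products of the icosahedron. -/
private def tv : Fin 3 → ℝ := ![-1, -(Real.sqrt 5 / 5), Real.sqrt 5 / 5]

/-- Their multiplicities around a vertex. -/
private def mv : Fin 3 → ℝ := ![1, 5, 5]

section config

variable {C : Finset (EuclideanSpace ℝ (Fin 3))} (h1 : ∀ x ∈ C, ‖x‖ = 1) (hN : C.card = 12)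
include h1 hN

/-- The universal `(1+t)^k` bound in the indexed form of `GroundStateSeries`. -/
private theorem bound (k : ℕ) :
    (12 : ℝ) * ∑ i : Fin 3, mv i * (1 + tv i) ^ k ≤ ∑ x ∈ C, ∑ y ∈ C.erase x, (1 + inner ℝ x y) ^ k := by
  have h := Energy.UniversalIcosahedron.ckPow_energy_ge k C h1 hN
  simp only [Fin.sum_univ_succ, Fin.sum_univ_zero, mv, tv, Matrix.cons_val_zero, Matrix.cons_val_succ] at h ⊢
  convert h using 1
  ring

omit h1 hN in
/-- The node values lie in `[-1, 1)`. -/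
private theorem nodes_mem : ∀ i : Fin 3, -1 ≤ tv i ∧ tv i < 1 := by
  have hlo : (2.236 : ℝ) < Real.sqrt 5 := (Real.lt_sqrt (by norm_num)).mpr (by norm_num)
  have hhi : Real.sqrt 5 < 2.2361 := (Real.sqrt_lt' (by norm_num)).mpr (by norm_num)
  intro i
  fin_cases i <;> simp [tv] <;> (try constructor) <;> nlinarith [hlo, hhi]

/-- **Unique ground state for absolutely monotone potentials** (`k ≥ 6`, `a^(k)(-1) > 0`): the minimiser is an
isometric image of the regular icosahedron. [cite: CohnKumar2006, Theorem 1.2] -/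
theorem isometric_pts_of_energy_eq_of_absolutelyMonotoneOn (a : ℝ → ℝ) (ha : AbsolutelyMonotoneOn a (Ico (-1) 1))
    (k : ℕ) (hk : 6 ≤ k) (hpos : 0 < iteratedDerivWithin k a (Ico (-1) 1) (-1))
    (hE : ∑ x ∈ C, ∑ y ∈ C.erase x, a (inner ℝ x y) =
      (12 : ℝ) * (a (-1 : ℝ) + 5 * a (-(Real.sqrt 5 / 5)) + 5 * a (Real.sqrt 5 / 5))) :
    ∃ Ψ : EuclideanSpace ℝ (Fin 3) ≃ₗᵢ[ℝ] EuclideanSpace ℝ (Fin 3), C = Icosahedron.pts.image Ψ := by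
  have h := GroundStateSeries.ckPow_energy_eq_of_absolutelyMonotoneOn h1 12 tv mv nodes_mem (bound h1 hN) a ha
    hpos (by rw [hE]; simp [Fin.sum_univ_succ, tv, mv]; ring)
  refine IcosahedronUnique.isometric_icosahedron_of_ckPow_energy_eq h1 hN k hk ?_
  rw [h]; simp [Fin.sum_univ_succ, tv, mv]; ring

/-- **The regular icosahedron is the unique minimiser of every Riesz energy among `12` points on `S²`** (`p > 0`;
energy `Σ_(x ≠ y) (2 - 2⟪x,y⟫)^(-p) = Σ |x-y|^(-2p)`; the minimum is
`Energy.RieszAbsolutelyMonotone.riesz_energy_ge_Icosahedron`). [cite: CohnKumar2006, Theorem 1.2] -/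
theorem riesz_ground_state_unique (p : ℝ) (hp : 0 < p)
    (hE : ∑ x ∈ C, ∑ y ∈ C.erase x, (2 - 2 * inner ℝ x y) ^ (-p) =
      (12 : ℝ) * ((4 : ℝ) ^ (-p) + 5 * (2 - 2 * (-(Real.sqrt 5 / 5))) ^ (-p)
        + 5 * (2 - 2 * (Real.sqrt 5 / 5)) ^ (-p))) :
    ∃ Ψ : EuclideanSpace ℝ (Fin 3) ≃ₗᵢ[ℝ] EuclideanSpace ℝ (Fin 3), C = Icosahedron.pts.image Ψ := by
  refine isometric_pts_of_energy_eq_of_absolutelyMonotoneOn h1 hN (fun t : ℝ => (2 - 2 * t) ^ (-p))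
    (Energy.RieszAbsolutelyMonotone.absolutelyMonotoneOn_rpow_chordal p hp.le) 6 le_rfl
    (E8GroundState.iteratedDerivWithin_rpow_chordal_pos p hp 6) ?_
  rw [hE]
  norm_num

end config

end Summit.Ventures.PackingBounds.Config.IcosahedronGroundState

end
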